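import Literature.Algebra.EuclideanLattices.KhotParameters
import Literature.Computability.Complexity.GapSetCover
import HarnessLib

/-!
# Khot 2005, Thm. 1.1 (constant factors, `p = 2`): the gap-instance theorem for GIVEN data, and the two sides of `gapSetCover 40`

Topic `Algebra/EuclideanLattices`, namespace `Literature.Algebra.EuclideanLattices.Khot`. A brick of
the decomposition of `Literature.Algebra.EuclideanLattices.gapSVP_const_isNPHardRandomized` (pqc.S17)
through `Khot2005_SAT_randReducible_gapSVP` (`KhotSVPHardness.lean`), on the way from the landed
MATHEMATICAL form of Khot's theorem (`khot_gap_instances`, `KhotParameters.lean`) to the machine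
level (an `FP` map on `⟨instance code, coins⟩`, `promiseRandReducible_of_cnt` of
`MetaComplexity/PromiseRandReductionsCounting.lean`). Two things a machine-level assembly needs and
`khot_gap_instances` does not expose, both PROVED here without new mathematics:

* `khot_gap_instances_of` — the same YES/NO error counts (`≤ 2/100`, `≤ 1/100` of the sample
  space `(Fin 31K → Fin N) × (rows → ℤ/q)`) for an ARBITRARY `{0,1}`-matrix `P` with `40K`-wise
  independent columns, ARBITRARY equivalences `eR, eC` to `Fin N_f` and an ARBITRARY number of
  levels `k` with `8γ₀² < (8/7)^k` — the data a machine computes explicitly (its own BCH matrix over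
  its own model of `GF(2^m)`, `bch01Matrix` of `BCHIndependence.lean`; its own enumeration order)
  — instead of the existentially chosen `P` (`exists_bch01Matrix`, via `GaloisField`),
  `Fintype.equivFin` and `k` of `khot_gap_instances`. The proof is the proof of `khot_gap_instances`
  with the three `obtain`s turned into hypotheses (nothing else changes).
* `setSystem I` (the set system `Fin σ → Finset (Fin u)` of a coded `SetCoverInstance`),
  `exactCover_of_mem_yesSet`, `noCover_of_mem_noSet` — the YES/NO sides of the promise problem
  `gapSetCover 40` (`GapSetCover.lean`: an exact cover of size `K ≥ 1`; every cover has size `≥ 40K`)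
  in the form consumed by `khot_gap_instances(_of)` (`∃ T₀, |T₀| = K ∧ ∀ e, #{j ∈ T₀ | e ∈ F j} = 1`;
  `∀ T₀, |T₀| < 40K → ∃ e ∉ ⋃_{j ∈ T₀} F j`), i.e. conditions (3)/(4) of Khot's Thm. 3.1 input.

## References

* S. Khot, *Hardness of approximating the shortest vector problem in lattices*, J. ACM 52 (2005)
  789–808, Thm. 1.1, Thm. 3.1, Thm. 4.1 ("it can be constructed efficiently"), §7.3.
* S. Arora, L. Babai, J. Stern, Z. Sweedyk, J. Comput. Syst. Sci. 54 (1997) 317–331, Prop. 6.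
-/

noncomputable section

namespace Literature.Algebra.EuclideanLattices.Khot

open Matrix Finset Params
open Literature.Computability.Complexity (SetCoverInstance)

/-! ### The gap-instance theorem for given `P`, `eR`, `eC`, `k` -/

section Given

open Classical in
/-- **Khot 2005, Thm. 1.1 (first assertion), Euclidean norm, for GIVEN auxiliary data.** Let
`γ₀ ≥ 1` and `k` with `8γ₀² < (8/7)^k`; let `F` be a set system on a universe of size `u ≥ 1` with
`σ` sets, `K ≥ 1`, and, for the explicit parameters of `Params`, let `P` be ANY `{0,1}`-matrix with
`20K·(M+1)` rows and `N` columns whose columns are `40K`-wise independent over `GF(2)` (`DWise`,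
e.g. `bch01Matrix` for any model of `GF(2^{M+1})`), and `eR, eC` ANY equivalences of the output
index types with `Fin N_f`. Then over `Ω = (Fin 31K → Fin N) × (rows → ℤ/q)`: (YES) an exact cover
by `K` sets ⇒ at most `2/100` of `Ω` gives an instance outside `GapSVP.yes`; (NO) no cover by
`< 40K` sets ⇒ at most `1/100` of `Ω` gives an instance outside `GapSVP.no γ₀`. (The statement of
`khot_gap_instances` with its existential choices made parameters; same proof.)
[cite: Khot2005, Thm. 1.1 and §7.3] -/
theorem khot_gap_instances_of (γ₀ : ℝ) (hγ₀ : 1 ≤ γ₀) (k : ℕ) (hk : 8 * γ₀ ^ 2 < (8 / 7 : ℝ) ^ k)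
    (u σ K : ℕ) (hu : 1 ≤ u) (hK : 1 ≤ K) (F : Fin σ → Finset (Fin u))
    (P : Matrix (Fin (20 * K) × Fin (MM u σ K k + 1)) (Fin (NN u σ K k)) ℤ)
    (hP01 : ∀ r i, P r i = 0 ∨ P r i = 1) (hDW : DWise P (40 * K)) (Nf : ℕ)
    (eR : Out (RowsT u σ K k ⊕ Unit) (ColsT u σ K k) k ≃ Fin Nf)
    (eC : (Coef (ColsT u σ K k) k ⊕ {o // augPad (n := ColsT u σ K k)
      (basePad (S := Fin σ) (H := Fin (20 * K) × Fin (MM u σ K k + 1)) (Nn := Fin (NN u σ K k))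
        (⟨0, hu⟩ : Fin u)) k o}) ≃ Fin Nf) :
    ((∃ T₀ : Finset (Fin σ), T₀.card = K ∧ ∀ e : Fin u, (T₀.filter fun j => e ∈ F j).card = 1) →
      100 * #((univ : Finset ((Fin (31 * K) → Fin (NN u σ K k)) × (RowsT u σ K k → ZMod (qq u σ K k)))).filter
          fun ω => khotInstance (DD u σ K k : ℤ) F P (tupleShift P ω.1) (DD u σ K k : ℤ) (qq u σ K k)
            (⟨0, hu⟩ : Fin u) ((ss u σ K k ^ k : ℕ) : ℤ) k (DD u σ K k : ℤ) (tauN u σ K k : ℚ) eR eC ω.2 ∉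
              GapSVP.yes fun _ => γ₀) ≤
        2 * (Fintype.card (Fin (NN u σ K k)) ^ (31 * K) * qq u σ K k ^ Fintype.card (RowsT u σ K k))) ∧
    ((∀ T₀ : Finset (Fin σ), T₀.card < 40 * K → ∃ e : Fin u, ∀ j ∈ T₀, e ∉ F j) →
      100 * #((univ : Finset ((Fin (31 * K) → Fin (NN u σ K k)) × (RowsT u σ K k → ZMod (qq u σ K k)))).filter
          fun ω => khotInstance (DD u σ K k : ℤ) F P (tupleShift P ω.1) (DD u σ K k : ℤ) (qq u σ K k)
            (⟨0, hu⟩ : Fin u) ((ss u σ K k ^ k : ℕ) : ℤ) k (DD u σ K k : ℤ) (tauN u σ K k : ℚ) eR eC ω.2 ∉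
              GapSVP.no fun _ => γ₀) ≤
        Fintype.card (Fin (NN u σ K k)) ^ (31 * K) * qq u σ K k ^ Fintype.card (RowsT u σ K k)) := by
  classical
  have hrowsne : 0 < Fintype.card (RowsT u σ K k) :=
    Fintype.card_pos_iff.2 ⟨Sum.inl (Sum.inl ⟨0, hu⟩)⟩
  have hNf : 0 < Nf := by
    have h := Fintype.card_congr eC
    rw [Fintype.card_fin, Fintype.card_sum, card_coef] at h
    rw [← h]
    exact Nat.add_pos_left (pow_pos (Fintype.card_pos_iff.2 ⟨Sum.inr ()⟩) _) _
  refine ⟨?_, ?_⟩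
  · -- YES
    rintro ⟨T₀, hTK, hTex⟩
    have hT₀ := cvpBasis_indicator_sub_target (DD u σ K k : ℤ) F T₀ hTex
    have hQ : (1 : ℤ) ≤ (DD u σ K k : ℤ) := by exact_mod_cast one_le_DD u σ K k hK
    have hS1 : 100 * (#((univ : Finset (Fin (31 * K) → Fin (NN u σ K k))).filter fun g => ¬Function.Injective g) +
        2 ^ Fintype.card (Fin (20 * K) × Fin (MM u σ K k + 1)) * B' u σ K k) ≤ Fintype.card (Fin (NN u σ K k)) ^ (31 * K) := by
      rw [Fintype.card_prod, Fintype.card_fin, Fintype.card_fin, Fintype.card_fin,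
        show 20 * K * (MM u σ K k + 1) = hh u σ K k from rfl]
      refine hS1_of u σ K k hK ?_
      have h := card_not_injective_le (α := Fin (NN u σ K k)) (31 * K)
      rw [Fintype.card_fin] at h
      exact h.trans (le_of_eq (by ring))
    have hs1 := one_le_ss u σ K k
    have hsW : (((ss u σ K k : ℕ) : ℤ)) ^ k ≤ (((ss u σ K k ^ k : ℕ) : ℤ)) ^ 2 := by
      rw [Nat.cast_pow, ← pow_mul]
      exact pow_le_pow_right₀ (by exact_mod_cast hs1) (by omega)
    have hle : (((2 * ((ss u σ K k ^ k : ℕ) : ℤ) ^ 2 * (35 * K : ℤ) ^ (k + 1) : ℤ)) : ℝ) ≤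
        ((tauN u σ K k : ℚ) : ℝ) ^ 2 := by
      have h1 := (XX_lt_tau_sq u σ K k).le
      have h2 : ((2 * ((ss u σ K k ^ k : ℕ) : ℤ) ^ 2 * (35 * K : ℤ) ^ (k + 1) : ℤ)) = (XX u σ K k : ℤ) := by
        unfold XX; push_cast; ring
      rw [h2, Rat.cast_natCast]
      exact_mod_cast h1
    have h := card_bad_yes_total_le (q := qq u σ K k) (U := Fin u) (S := Fin σ)
      (H := Fin (20 * K) × Fin (MM u σ K k + 1)) (Nn := Fin (NN u σ K k)) hQ hP01 hT₀
      (rr := 31 * K) (by omega) (B' := B' u σ K k) hS1 (le_of_eq (by unfold B'; rfl))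
      hQ (⟨0, hu⟩ : Fin u) (W := ((ss u σ K k ^ k : ℕ) : ℤ)) (by exact_mod_cast Nat.one_le_pow _ _ hs1) k
      (g₀ := (35 * K : ℤ)) (s := (ss u σ K k : ℤ)) (by rw [hTK]; push_cast; ring) (by
        have : (1 : ℤ) ≤ K := by exact_mod_cast hK
        linarith)
      (by
        rw [hTK, Fintype.card_prod, Fintype.card_fin, Fintype.card_fin]
        unfold ss hh
        push_cast; ring)
      hsW (T := (DD u σ K k : ℤ)) (by positivity) eR eC (fun _ => γ₀) (τ := (tauN u σ K k : ℚ))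
      (by unfold tauN; positivity) hle
    exact h
  · -- NO
    intro hNO
    have hD1 := one_le_DD u σ K k hK
    have hQ : (1 : ℤ) ≤ (DD u σ K k : ℤ) := by exact_mod_cast hD1
    have hs1 := one_le_ss u σ K k
    -- `100·#A·D ≤ q` for every shift
    have hq : ∀ g : Fin (31 * K) → Fin (NN u σ K k),
        100 * #(annoyingVectors (intBasis (DD u σ K k : ℤ) F P (tupleShift P g)) (40 * K) (DD u σ K k)) *
          DD u σ K k ≤ qq u σ K k := by
      intro g
      have hA := card_annoyingVectors_intBasis_le (Q := (DD u σ K k : ℤ)) (by positivity) F hNO hDW le_rfl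
        hD1 (tupleShift P g) hrowsne
      rw [card_RowsT] at hA
      rw [qq_eq u σ K k hK]
      unfold Abound
      exact Nat.mul_le_mul_right _ (Nat.mul_le_mul_left 100 hA)
    have hDk : (((ss u σ K k ^ k : ℕ) : ℤ)) ^ 2 * ((40 * K : ℕ) : ℤ) ^ (k + 1) ≤ ((DD u σ K k : ℕ) : ℤ) ^ 2 := by
      have e : ((DD u σ K k : ℕ) : ℤ) = ((ss u σ K k ^ k : ℕ) : ℤ) * ((40 * K : ℕ) : ℤ) ^ (k + 1) := by
        unfold DD; push_cast; ring
      rw [e, mul_pow]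
      refine mul_le_mul_of_nonneg_left ?_ (sq_nonneg _)
      have h1 : (1 : ℤ) ≤ ((40 * K : ℕ) : ℤ) ^ (k + 1) := one_le_pow₀ (by exact_mod_cast (show 1 ≤ 40 * K by omega))
      exact le_self_pow₀ h1 two_ne_zero
    have hbT : (((ss u σ K k ^ k : ℕ) : ℤ)) ^ 2 * ((40 * K : ℕ) : ℤ) ^ (k + 1) ≤ ((DD u σ K k : ℤ) + 1) ^ 2 :=
      hDk.trans (by nlinarith)
    have hlt : (γ₀ * ((tauN u σ K k : ℚ) : ℝ)) ^ 2 <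
        (((((ss u σ K k ^ k : ℕ) : ℤ)) ^ 2 * ((40 * K : ℕ) : ℤ) ^ (k + 1) : ℤ) : ℝ) := by
      have h1 : ((tauN u σ K k : ℚ) : ℝ) ^ 2 ≤ 4 * (XX u σ K k : ℝ) := by
        rw [Rat.cast_natCast]; exact_mod_cast tau_sq_le u σ K k hK
      have hk' : 8 * γ₀ ^ 2 < (8 / 7 : ℝ) ^ (k + 1) :=
        hk.trans_le (pow_le_pow_right₀ (by norm_num) (Nat.le_succ k))
      have hXX : (XX u σ K k : ℝ) = 2 * ((ss u σ K k : ℝ) ^ k) ^ 2 * (35 * K) ^ (k + 1) := by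
        unfold XX; push_cast; ring
      have hpos : (0 : ℝ) < ((ss u σ K k : ℝ) ^ k) ^ 2 * (35 * K) ^ (k + 1) := by
        have : (1 : ℝ) ≤ ss u σ K k := by exact_mod_cast hs1
        have : (1 : ℝ) ≤ K := by exact_mod_cast hK
        positivity
      have htarget : (((((ss u σ K k ^ k : ℕ) : ℤ)) ^ 2 * ((40 * K : ℕ) : ℤ) ^ (k + 1) : ℤ) : ℝ) =
          ((ss u σ K k : ℝ) ^ k) ^ 2 * ((8 / 7 : ℝ) ^ (k + 1) * (35 * K) ^ (k + 1)) := by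
        have e : (8 / 7 : ℝ) ^ (k + 1) * (35 * (K : ℝ)) ^ (k + 1) = (40 * (K : ℝ)) ^ (k + 1) := by
          rw [← mul_pow]; congr 1; ring
        rw [e]; push_cast; ring
      rw [htarget]
      calc (γ₀ * ((tauN u σ K k : ℚ) : ℝ)) ^ 2 = γ₀ ^ 2 * ((tauN u σ K k : ℚ) : ℝ) ^ 2 := by ring
        _ ≤ γ₀ ^ 2 * (4 * (XX u σ K k : ℝ)) := mul_le_mul_of_nonneg_left h1 (by positivity)
        _ = 8 * γ₀ ^ 2 * (((ss u σ K k : ℝ) ^ k) ^ 2 * (35 * K) ^ (k + 1)) := by rw [hXX]; ring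
        _ < (8 / 7 : ℝ) ^ (k + 1) * (((ss u σ K k : ℝ) ^ k) ^ 2 * (35 * K) ^ (k + 1)) :=
            mul_lt_mul_of_pos_right hk' hpos
        _ = ((ss u σ K k : ℝ) ^ k) ^ 2 * ((8 / 7 : ℝ) ^ (k + 1) * (35 * K) ^ (k + 1)) := by ring
    have h := card_bad_no_total_le (q := qq u σ K k) (U := Fin u) (S := Fin σ)
      (H := Fin (20 * K) × Fin (MM u σ K k + 1)) (Nn := Fin (NN u σ K k)) hQ F hP01 (31 * K)
      (d := 40 * K) (D := DD u σ K k) hD1 hq (⟨0, hu⟩ : Fin u) (W := ((ss u σ K k ^ k : ℕ) : ℤ))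
      (by exact_mod_cast Nat.one_le_pow _ _ hs1) k hDk (T := (DD u σ K k : ℤ)) (by positivity) hbT hNf eR eC
      (γ := fun _ => γ₀) (by linarith) (τ := (tauN u σ K k : ℚ)) (by unfold tauN; positivity) hlt
    exact h

/-- A number of levels as required by `khot_gap_instances_of` exists for every `γ₀`
(`(8/7)^k → ∞`); a machine uses any fixed such `k` (a constant depending on `γ₀` only, §7.3:
"choosing `k` to be a large enough constant"). [cite: Khot2005, §7.3] -/
theorem exists_levels (γ₀ : ℝ) : ∃ k : ℕ, 8 * γ₀ ^ 2 < (8 / 7 : ℝ) ^ k :=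
  pow_unbounded_of_one_lt (8 * γ₀ ^ 2) (by norm_num : (1 : ℝ) < 8 / 7)

end Given

/-! ### The two sides of `gapSetCover 40` in Khot's form -/

section SetCover

/-- **The set system of a set cover instance**: set `j < σ = |sets|` is the subset of the universe
`Fin u`, `u = univSize`, of the elements listed in `S_j` (list members `≥ u` are ignored, as in
`SetCoverInstance.IsCover`). [cite: AroraEtAl1997, Prop. 6 (p. 319)] -/
def setSystem (I : SetCoverInstance) : Fin I.sets.length → Finset (Fin I.univSize) :=
  fun j => univ.filter fun e => (e : ℕ) ∈ I.subsetAt j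

/-- Membership in `setSystem I j`. [folklore] -/
@[simp] theorem mem_setSystem (I : SetCoverInstance) (j : Fin I.sets.length) (e : Fin I.univSize) :
    e ∈ setSystem I j ↔ (e : ℕ) ∈ I.subsetAt j := by
  simp [setSystem]

/-- **YES instances of `gapSetCover c` in Khot's form** (Thm. 3.1 (3): "there are `ηd` sets that
cover each element of the universe exactly once"): `K ≥ 1` and some `T₀ ⊆ Fin σ` with `|T₀| = K`
covers every element of the universe exactly once. [cite: Khot2005, Thm. 3.1] -/
theorem exactCover_of_mem_yesSet {I : SetCoverInstance}
    (h : I ∈ Literature.Computability.Complexity.GapSetCover.yesSet) :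
    0 < I.K ∧ ∃ T₀ : Finset (Fin I.sets.length), T₀.card = I.K ∧
      ∀ e : Fin I.univSize, (T₀.filter fun j => e ∈ setSystem I j).card = 1 := by
  classical
  obtain ⟨hK, T, ⟨hTlt, hTex⟩, hTcard⟩ := h
  refine ⟨hK, T.attachFin hTlt, by rw [card_attachFin, hTcard], fun e => ?_⟩
  rw [← hTex e e.2]
  -- the two filtered sets correspond under `Fin.val`
  refine card_bij (fun j _ => (j : ℕ)) (fun j hj => ?_) (fun j₁ _ j₂ _ h => Fin.ext h) (fun m hm => ?_)
  · simp only [mem_filter, mem_attachFin, mem_setSystem] at hj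
    exact mem_filter.2 hj
  · obtain ⟨hmT, hme⟩ := mem_filter.1 hm
    refine ⟨⟨m, hTlt m hmT⟩, ?_, rfl⟩
    simp only [mem_filter, mem_attachFin, mem_setSystem]
    exact ⟨hmT, hme⟩

/-- **NO instances of `gapSetCover 40` in Khot's form** (Thm. 3.1 (4), "there is no set-cover of
size `d`", used as: fewer than `d = 40K` sets do not cover the universe): for every `T₀ ⊆ Fin σ`
with `|T₀| < 40K` some element lies in no `S_j`, `j ∈ T₀`. [cite: Khot2005, Thm. 3.1] -/
theorem noCover_of_mem_noSet {I : SetCoverInstance}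
    (h : I ∈ Literature.Computability.Complexity.GapSetCover.noSet 40) :
    ∀ T₀ : Finset (Fin I.sets.length), T₀.card < 40 * I.K →
      ∃ e : Fin I.univSize, ∀ j ∈ T₀, e ∉ setSystem I j := by
  classical
  intro T₀ hcard
  by_contra hcov
  push Not at hcov
  -- then `T₀` (as naturals) is a cover of size `< 40K`
  have hcover : I.IsCover (T₀.map Fin.valEmbedding) := by
    refine ⟨fun j hj => ?_, fun e he => ?_⟩
    · obtain ⟨j', -, rfl⟩ := mem_map.1 hj
      exact j'.2
    · obtain ⟨j, hjT, hje⟩ := hcov ⟨e, he⟩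
      exact ⟨j, mem_map_of_mem _ hjT, (mem_setSystem I j ⟨e, he⟩).1 hje⟩
  have hle := h _ hcover
  rw [card_map] at hle
  have : (40 : ℚ) * I.K ≤ T₀.card := hle
  have hlt : (T₀.card : ℚ) < 40 * I.K := by exact_mod_cast hcard
  linarith

/-- NO instances with `K = 0` are all instances with `K = 0` (every cover has size `≥ 0`); in
particular an instance with `K = 0` is never a YES instance, and a reduction may send all of them
to one fixed NO instance of the target. [cite: AroraEtAl1997, Prop. 6 (p. 319)] -/
theorem mem_noSet_of_K_eq_zero {I : SetCoverInstance} (hK : I.K = 0) (c : ℚ) :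
    I ∈ Literature.Computability.Complexity.GapSetCover.noSet c := by
  intro T _
  rw [hK, Nat.cast_zero, mul_zero]
  exact Nat.cast_nonneg _

/-- YES instances have `K ≥ 1` (by definition of `GapSetCover.yesSet`). [cite: AroraEtAl1997, Prop. 6 (p. 319)] -/
theorem one_le_K_of_mem_yesSet {I : SetCoverInstance}
    (h : I ∈ Literature.Computability.Complexity.GapSetCover.yesSet) : 1 ≤ I.K :=
  h.1

/-- With an EMPTY universe, an instance with `K ≥ 1` is not a NO instance of `gapSetCover c` for
`c > 0` (the empty family is a cover of size `0 < c·K`); so a reduction may send all instances with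
`u = 0`, `K ≥ 1` to one fixed YES instance of the target. [cite: AroraEtAl1997, Prop. 6 (p. 319)] -/
theorem not_mem_noSet_of_univSize_eq_zero {I : SetCoverInstance} (hu : I.univSize = 0) (hK : 1 ≤ I.K)
    {c : ℚ} (hc : 0 < c) : I ∉ Literature.Computability.Complexity.GapSetCover.noSet c := by
  intro h
  have hcov : I.IsCover ∅ := ⟨fun j hj => (notMem_empty j hj).elim, fun e he => by omega⟩
  have := h ∅ hcov
  rw [card_empty, Nat.cast_zero] at this
  have hK' : (1 : ℚ) ≤ I.K := by exact_mod_cast hK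
  nlinarith

end SetCover

end Literature.Algebra.EuclideanLattices.Khot
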